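import Summits.QuantumFields.YangMills.Theorems.VirialFluxGapPeriodicSoftnessOfCentralField
import Summits.QuantumFields.YangMills.Theorems.VirialFluxGapCentralSignSelector
import HarnessLib

/-!
# Route `VirialFluxGap` (YangMills): ASSEMBLY OF THE PATCHED EULER FIELD ON `X_fix`, PART VI — the 16 SIGN CHARTS of the central region
# patched into ONE global smooth central field (w2's smooth sign selectors), and `PeriodicSoftness` from PER-SIGN central packages

Toward the deciding crux `VirialFluxGap.PeriodicSoftness` (item stmt-QuantumFields-24141).  The central chart theorems of the team
(✓`exists_fixChart_centralProj`, ✓`ringDeficit_centralProj_le_mul`, w3's explicit field `centralCoeff L σ σ₄`) are stated PER SIGN PATTERN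
`σ ∈ {±1}³`, `σ₄ ∈ {±1}` under the hypotheses `½ ≤ σ_k·Re su2Quat(w_k)`, `½ ≤ σ₄·Re su2Quat(seam root)`, whereas ✓`periodicSoftness_of_centralField`
(Part V) wants ONE global smooth family `C`.  This file bridges the two with w2's smooth, locally constant selectors ✓`linkSign`, ✓`seamSign`:
`C_va := Σ_b w_b·(C_b)_va`, `w_b(M) = Π_k (1 + s(b₁k)·linkSign k M)/2 · (1 + s(b₂)·seamSign M)/2` (`b ∈ (Fin 3 → Bool) × Bool`, `s(true) = 1`,
`s(false) = −1`).  On the `ρ`-central region (`ρ² ≤ 3/4`) the selectors are `±1` with zero frame derivatives (✓`signStep_central`,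
✓`frameD_linkSign_ringCoord_eq_zero`), so exactly one weight is `1`, the others `0`, all flat: drive, divergence and mass derivatives of `C` are those of
the selected chart, whose sign hypotheses hold.

* §1 letters: `frameD_affine`, `frameD_finset_sum'`, `signFactor_eq` (a factor `(1 + c·s)/2` with `c, s = ±1` is `1` or `0`);
* §2 ★★ `exists_centralField_of_signCharts` — per-sign packages (P2)(P3)(P4) ⇒ ∃ ONE smooth `C` with the σ-free package of Part V;
* §3 ★★★ `periodicSoftness_of_signCharts` — `PeriodicSoftness` BY NAME from per-sign central packages for all large `L`.

HONEST LABEL: plumbing for a CONDITIONAL assembly (the per-sign central packages are HYPOTHESES, w3 lineage); nothing is closed; ⟨24141⟩, ⟨22884⟩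
remain OPEN; the Yang–Mills mass gap is NOT proved; no summit is proved by a line.  THEOREMS ONLY (0 `def`, 0 `sorry`), standard axioms.
Explicit-unit seat `ym-line-fcl-p3` g41 (cell ym-idea-1, free hands; default assembler), `--supports stmt-QuantumFields-24141`.
References: [cite: Luscher1983, §2]; [folklore].
-/

set_option autoImplicit false

noncomputable section

open scoped Matrix BigOperators ContDiff Topology Quaternion
open MeasureTheory Set Matrix
open Literature.MathematicalPhysics.QuantumFieldTheory hiding SU2
open Literature.MathematicalPhysics.QuantumLattice
open Literature.MathematicalPhysics.QuantumFieldTheory.SUNBakryEmery (expSU coe_expSU matTop)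

namespace Summit.QuantumFields.YangMills.Theorems.VirialFluxGap.FrameHessian

open Summit.QuantumFields.YangMills.Theorems.FemtoTransferGap
open Summit.QuantumFields.YangMills.Theorems.FemtoTransferGap.TT
open Summit.QuantumFields.YangMills.Theorems.FemtoTransferGap.TwoLattice
open Summit.QuantumFields.YangMills.Theorems.FemtoTransferGap.TwoLattice.Flat
open Summit.QuantumFields.YangMills.Theorems.VirialFluxGap.RingDeficit
open Summit.QuantumFields.YangMills.Theorems.VirialFluxGap.FrameDerivative
open Summit.QuantumFields.YangMills.Theorems.VirialFluxGap.ResolventField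
open Summit.QuantumFields.YangMills.Theorems.VirialFluxGap.RegularValley
open Summit.QuantumFields.YangMills.Theorems.VirialFluxGap.FixFrame
open Summit.QuantumFields.YangMills.Theorems.VirialFluxGap.RegCutoff

variable {L : ℕ} [NeZero L]

open scoped Matrix.Norms.Frobenius

/-! ## §1 Letters -/

/-- Frame derivative of an affine function of a smooth function: `∂_Y(a + c·f) = c·∂_Y f`. [folklore] -/
theorem frameD_affine {f : ((Fin (2 * L - 1 + 1) → Edge 3 L → Matrix (Fin 2) (Fin 2) ℂ) × (Site 3 L → Matrix (Fin 2) (Fin 2) ℂ)) → ℝ}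
    (hf : ContDiff ℝ ∞ f) (a c : ℝ) (Y : ((Fin (2 * L - 1 + 1) × Edge 3 L) ⊕ Site 3 L) → Matrix (Fin 2) (Fin 2) ℂ)
    (M : (Fin (2 * L - 1 + 1) → Edge 3 L → Matrix (Fin 2) (Fin 2) ℂ) × (Site 3 L → Matrix (Fin 2) (Fin 2) ℂ)) :
    frameD Y (fun M' => a + c * f M') M = c * frameD Y f M := by
  rw [frameD_fun_add Y contDiff_const (contDiff_const.mul hf), frameD_const_mul Y hf]
  have h0 : frameD Y (fun _ : ((Fin (2 * L - 1 + 1) → Edge 3 L → Matrix (Fin 2) (Fin 2) ℂ) × (Site 3 L → Matrix (Fin 2) (Fin 2) ℂ)) => a) M = 0 := by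
    rw [frameD, fderiv_const_apply, _root_.zero_apply]
  rw [h0, zero_add]

/-- Frame derivative of a finite sum of smooth functions. [folklore] -/
theorem frameD_finset_sum' {β : Type*} (s : Finset β)
    {f : β → ((Fin (2 * L - 1 + 1) → Edge 3 L → Matrix (Fin 2) (Fin 2) ℂ) × (Site 3 L → Matrix (Fin 2) (Fin 2) ℂ)) → ℝ}
    (hf : ∀ b, ContDiff ℝ ∞ (f b)) (Y : ((Fin (2 * L - 1 + 1) × Edge 3 L) ⊕ Site 3 L) → Matrix (Fin 2) (Fin 2) ℂ)
    (M : (Fin (2 * L - 1 + 1) → Edge 3 L → Matrix (Fin 2) (Fin 2) ℂ) × (Site 3 L → Matrix (Fin 2) (Fin 2) ℂ)) :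
    frameD Y (fun M' => ∑ b ∈ s, f b M') M = ∑ b ∈ s, frameD Y (f b) M := by
  unfold frameD
  have h : (fun M' => ∑ b ∈ s, f b M') = ∑ b ∈ s, f b := by funext M'; exact (Finset.sum_apply M' s f).symm
  rw [h, fderiv_sum fun b _ => ((hf b).differentiable (by simp)).differentiableAt]
  simp only [FunLike.coe_sum, Finset.sum_apply]

omit [NeZero L] in
/-- A sign factor `(1 + c·s)/2` with `c, s ∈ {1, −1}` equals `1` if `c = s` and `0` otherwise. [folklore] -/
theorem signFactor_eq {c s : ℝ} (hc : c = 1 ∨ c = -1) (hs : s = 1 ∨ s = -1) :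
    (1 + c * s) / 2 = if c = s then 1 else 0 := by
  rcases hc with rfl | rfl <;> rcases hs with rfl | rfl <;> norm_num

/-! ## §2 One global smooth central field from the 16 sign charts -/

/-- ★★ **ONE GLOBAL SMOOTH CENTRAL FIELD FROM THE 16 SIGN CHARTS.**  Given, for every sign pattern `b` (`s(b₁k), s(b₂) ∈ {±1}`), smooth
coefficient functions `C_b` satisfying the central package (P2)(P3)(P4) at the `ρ`-central window points WITH the sign hypotheses
`½ ≤ s(b₁k)·Re su2Quat(wrapReps …)`, `½ ≤ s(b₂)·Re su2Quat(seam root)` (`ρ² ≤ 3/4`), there is ONE smooth family `C` satisfying the σ-free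
package of ✓`periodicSoftness_of_centralField` (the patched `Σ_b w_b·C_b`). [cite: Luscher1983, §2] -/
theorem exists_centralField_of_signCharts {ρ t_C N ε_C : ℝ} (hρ2 : ρ ^ 2 ≤ 3 / 4)
    (Cfam : (Fin 3 → Bool) × Bool → FixVar L × Fin 3 →
      ((Fin (2 * L - 1 + 1) → Edge 3 L → Matrix (Fin 2) (Fin 2) ℂ) × (Site 3 L → Matrix (Fin 2) (Fin 2) ℂ)) → ℝ)
    (hCs : ∀ b va, ContDiff ℝ ∞ (Cfam b va))
    (hP : ∀ (b : (Fin 3 → Bool) × Bool) (x : (OffIdx L → SU2) × ((Fin (2 * L - 1) → GaugeConfig 3 L SU2) × (Site 3 L → SU2))),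
      (∀ k : Fin 3, 1 - (su2Quat (wrapReps ((Fin.cons (glue x.1) x.2.1 : Fin (2 * L - 1 + 1) → GaugeConfig 3 L SU2) 0) k)).re ^ 2 ≤ ρ ^ 2) →
      1 - (su2Quat (x.2.2 0)).re ^ 2 ≤ ρ ^ 2 →
      (∀ k : Fin 3, 1 / 2 ≤ (if b.1 k then (1 : ℝ) else -1) *
        (su2Quat (wrapReps ((Fin.cons (glue x.1) x.2.1 : Fin (2 * L - 1 + 1) → GaugeConfig 3 L SU2) 0) k)).re) →
      1 / 2 ≤ (if b.2 then (1 : ℝ) else -1) * (su2Quat (x.2.2 0)).re →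
      ringDeficit L (fun _ => false) ((Fin.cons (glue x.1) x.2.1 : Fin (2 * L - 1 + 1) → GaugeConfig 3 L SU2), x.2.2) ≤ t_C →
      2 * (1 - ε_C) * ringDeficit L (fun _ => false) ((Fin.cons (glue x.1) x.2.1 : Fin (2 * L - 1 + 1) → GaugeConfig 3 L SU2), x.2.2) ≤
          ∑ va, Cfam b va (ringCoord L ((Fin.cons (glue x.1) x.2.1 : Fin (2 * L - 1 + 1) → GaugeConfig 3 L SU2), x.2.2)) *
            frameGrad (L := L) fixFrameStd (ringCoord L ((Fin.cons (glue x.1) x.2.1 : Fin (2 * L - 1 + 1) → GaugeConfig 3 L SU2), x.2.2)) va ∧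
        ∑ va, frameD (fixFrameStd va) (Cfam b va) (ringCoord L ((Fin.cons (glue x.1) x.2.1 : Fin (2 * L - 1 + 1) → GaugeConfig 3 L SU2), x.2.2)) ≤
          18 * (L : ℝ) ^ 4 - 1 / 2 ∧
        (∀ k : Fin 3, -(N * Real.sqrt (ringDeficit L (fun _ => false) ((Fin.cons (glue x.1) x.2.1 : Fin (2 * L - 1 + 1) → GaugeConfig 3 L SU2), x.2.2))) ≤
          ∑ va, Cfam b va (ringCoord L ((Fin.cons (glue x.1) x.2.1 : Fin (2 * L - 1 + 1) → GaugeConfig 3 L SU2), x.2.2)) *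
            frameD (fixFrameStd va) (linkMass k) (ringCoord L ((Fin.cons (glue x.1) x.2.1 : Fin (2 * L - 1 + 1) → GaugeConfig 3 L SU2), x.2.2))) ∧
        -(N * Real.sqrt (ringDeficit L (fun _ => false) ((Fin.cons (glue x.1) x.2.1 : Fin (2 * L - 1 + 1) → GaugeConfig 3 L SU2), x.2.2))) ≤
          ∑ va, Cfam b va (ringCoord L ((Fin.cons (glue x.1) x.2.1 : Fin (2 * L - 1 + 1) → GaugeConfig 3 L SU2), x.2.2)) *
            frameD (fixFrameStd va) seamMass (ringCoord L ((Fin.cons (glue x.1) x.2.1 : Fin (2 * L - 1 + 1) → GaugeConfig 3 L SU2), x.2.2))) :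
    ∃ C : FixVar L × Fin 3 → ((Fin (2 * L - 1 + 1) → Edge 3 L → Matrix (Fin 2) (Fin 2) ℂ) × (Site 3 L → Matrix (Fin 2) (Fin 2) ℂ)) → ℝ,
      (∀ va, ContDiff ℝ ∞ (C va)) ∧
      ∀ x : (OffIdx L → SU2) × ((Fin (2 * L - 1) → GaugeConfig 3 L SU2) × (Site 3 L → SU2)),
        (∀ k : Fin 3, 1 - (su2Quat (wrapReps ((Fin.cons (glue x.1) x.2.1 : Fin (2 * L - 1 + 1) → GaugeConfig 3 L SU2) 0) k)).re ^ 2 ≤ ρ ^ 2) →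
        1 - (su2Quat (x.2.2 0)).re ^ 2 ≤ ρ ^ 2 →
        ringDeficit L (fun _ => false) ((Fin.cons (glue x.1) x.2.1 : Fin (2 * L - 1 + 1) → GaugeConfig 3 L SU2), x.2.2) ≤ t_C →
        2 * (1 - ε_C) * ringDeficit L (fun _ => false) ((Fin.cons (glue x.1) x.2.1 : Fin (2 * L - 1 + 1) → GaugeConfig 3 L SU2), x.2.2) ≤
            ∑ va, C va (ringCoord L ((Fin.cons (glue x.1) x.2.1 : Fin (2 * L - 1 + 1) → GaugeConfig 3 L SU2), x.2.2)) *
              frameGrad (L := L) fixFrameStd (ringCoord L ((Fin.cons (glue x.1) x.2.1 : Fin (2 * L - 1 + 1) → GaugeConfig 3 L SU2), x.2.2)) va ∧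
          ∑ va, frameD (fixFrameStd va) (C va) (ringCoord L ((Fin.cons (glue x.1) x.2.1 : Fin (2 * L - 1 + 1) → GaugeConfig 3 L SU2), x.2.2)) ≤
            18 * (L : ℝ) ^ 4 - 1 / 2 ∧
          (∀ k : Fin 3, -(N * Real.sqrt (ringDeficit L (fun _ => false) ((Fin.cons (glue x.1) x.2.1 : Fin (2 * L - 1 + 1) → GaugeConfig 3 L SU2), x.2.2))) ≤
            ∑ va, C va (ringCoord L ((Fin.cons (glue x.1) x.2.1 : Fin (2 * L - 1 + 1) → GaugeConfig 3 L SU2), x.2.2)) *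
              frameD (fixFrameStd va) (linkMass k) (ringCoord L ((Fin.cons (glue x.1) x.2.1 : Fin (2 * L - 1 + 1) → GaugeConfig 3 L SU2), x.2.2))) ∧
          -(N * Real.sqrt (ringDeficit L (fun _ => false) ((Fin.cons (glue x.1) x.2.1 : Fin (2 * L - 1 + 1) → GaugeConfig 3 L SU2), x.2.2))) ≤
            ∑ va, C va (ringCoord L ((Fin.cons (glue x.1) x.2.1 : Fin (2 * L - 1 + 1) → GaugeConfig 3 L SU2), x.2.2)) *
              frameD (fixFrameStd va) seamMass (ringCoord L ((Fin.cons (glue x.1) x.2.1 : Fin (2 * L - 1 + 1) → GaugeConfig 3 L SU2), x.2.2)) := by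
  classical
  -- the sign weights
  set W : (Fin 3 → Bool) × Bool → ((Fin (2 * L - 1 + 1) → Edge 3 L → Matrix (Fin 2) (Fin 2) ℂ) × (Site 3 L → Matrix (Fin 2) (Fin 2) ℂ)) → ℝ :=
    fun b M => (1 + (if b.1 0 then (1 : ℝ) else -1) * linkSign 0 M) / 2 * ((1 + (if b.1 1 then (1 : ℝ) else -1) * linkSign 1 M) / 2) *
      ((1 + (if b.1 2 then (1 : ℝ) else -1) * linkSign 2 M) / 2) * ((1 + (if b.2 then (1 : ℝ) else -1) * seamSign M) / 2) with hWdef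
  have hfac : ∀ (c : ℝ) (k : Fin 3), ContDiff ℝ ∞ fun M : ((Fin (2 * L - 1 + 1) → Edge 3 L → Matrix (Fin 2) (Fin 2) ℂ) × (Site 3 L → Matrix (Fin 2) (Fin 2) ℂ)) =>
      (1 + c * linkSign k M) / 2 := fun c k => (contDiff_const.add (contDiff_const.mul (contDiff_linkSign k))).div_const _
  have hfacS : ∀ c : ℝ, ContDiff ℝ ∞ fun M : ((Fin (2 * L - 1 + 1) → Edge 3 L → Matrix (Fin 2) (Fin 2) ℂ) × (Site 3 L → Matrix (Fin 2) (Fin 2) ℂ)) =>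
      (1 + c * seamSign M) / 2 := fun c => (contDiff_const.add (contDiff_const.mul contDiff_seamSign)).div_const _
  have hWs : ∀ b, ContDiff ℝ ∞ (W b) := fun b => by
    rw [hWdef]
    exact (((hfac _ 0).mul (hfac _ 1)).mul (hfac _ 2)).mul (hfacS _)
  refine ⟨fun va M => ∑ b, W b M * Cfam b va M, fun va => ContDiff.sum fun b _ => (hWs b).mul (hCs b va), ?_⟩
  intro x hk hs hF
  set Mx := ringCoord L ((Fin.cons (glue x.1) x.2.1 : Fin (2 * L - 1 + 1) → GaugeConfig 3 L SU2), x.2.2) with hMx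
  -- the selectors at the point: `±1`, sign hypotheses, zero frame derivatives
  have hsel : ∀ k : Fin 3, (linkSign k Mx = 1 ∨ linkSign k Mx = -1) ∧
      1 / 2 ≤ linkSign k Mx * (su2Quat (wrapReps ((Fin.cons (glue x.1) x.2.1 : Fin (2 * L - 1 + 1) → GaugeConfig 3 L SU2) 0) k)).re := by
    intro k
    rw [hMx, linkSign_fixEmbed]
    have h := signStep_central (r := (su2Quat (wrapReps ((Fin.cons (glue x.1) x.2.1 : Fin (2 * L - 1 + 1) → GaugeConfig 3 L SU2) 0) k)).re)
      (by linarith [hk k])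
    exact ⟨h.1, h.2.2⟩
  have hselS : (seamSign Mx = 1 ∨ seamSign Mx = -1) ∧ 1 / 2 ≤ seamSign Mx * (su2Quat (x.2.2 0)).re := by
    rw [hMx, seamSign_ringCoord]
    have h := signStep_central (r := (su2Quat (x.2.2 0)).re) (by linarith [hs])
    exact ⟨h.1, h.2.2⟩
  have hDsel : ∀ (k : Fin 3) (Y : ((Fin (2 * L - 1 + 1) × Edge 3 L) ⊕ Site 3 L) → Matrix (Fin 2) (Fin 2) ℂ), frameD Y (linkSign k) Mx = 0 := by
    intro k Y
    refine frameD_linkSign_ringCoord_eq_zero k _ ?_ Y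
    rw [linkMass_fixEmbed]; linarith [hk k]
  have hDselS : ∀ Y : ((Fin (2 * L - 1 + 1) × Edge 3 L) ⊕ Site 3 L) → Matrix (Fin 2) (Fin 2) ℂ, frameD Y seamSign Mx = 0 := by
    intro Y
    refine frameD_seamSign_ringCoord_eq_zero _ ?_ Y
    rw [seamMass_fixEmbed]; linarith [hs]
  -- the selected pattern
  set bs : (Fin 3 → Bool) × Bool := (fun k => decide (linkSign k Mx = 1), decide (seamSign Mx = 1)) with hbsdef
  have hm11 : (-1 : ℝ) ≠ 1 := by norm_num
  have hsgn3 : ∀ k : Fin 3, (if bs.1 k then (1 : ℝ) else -1) = linkSign k Mx := by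
    intro k
    rcases (hsel k).1 with h | h
    · simp [hbsdef, h]
    · simp [hbsdef, h, hm11]
  have hsgn4 : (if bs.2 then (1 : ℝ) else -1) = seamSign Mx := by
    rcases hselS.1 with h | h
    · simp [hbsdef, h]
    · simp [hbsdef, h, hm11]
  -- the weights at the point: `1` on the selected pattern, `0` otherwise
  have hpm : ∀ t : Bool, (if t then (1 : ℝ) else -1) = 1 ∨ (if t then (1 : ℝ) else -1) = -1 := fun t => by cases t <;> simp
  have hWval : ∀ b, W b Mx = if b = bs then 1 else 0 := by
    intro b
    have e0 := signFactor_eq (hpm (b.1 0)) (hsel 0).1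
    have e1 := signFactor_eq (hpm (b.1 1)) (hsel 1).1
    have e2 := signFactor_eq (hpm (b.1 2)) (hsel 2).1
    have e3 := signFactor_eq (hpm b.2) hselS.1
    simp only [hWdef]
    rw [e0, e1, e2, e3, ← hsgn3 0, ← hsgn3 1, ← hsgn3 2, ← hsgn4]
    by_cases hb : b = bs
    · subst hb; simp
    · rw [if_neg hb]
      have hne : ¬ ((if b.1 0 then (1 : ℝ) else -1) = (if bs.1 0 then (1 : ℝ) else -1) ∧ (if b.1 1 then (1 : ℝ) else -1) = (if bs.1 1 then (1 : ℝ) else -1) ∧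
          (if b.1 2 then (1 : ℝ) else -1) = (if bs.1 2 then (1 : ℝ) else -1) ∧ (if b.2 then (1 : ℝ) else -1) = (if bs.2 then (1 : ℝ) else -1)) := by
        intro h
        apply hb
        have hbool : ∀ t t' : Bool, (if t then (1 : ℝ) else -1) = (if t' then (1 : ℝ) else -1) → t = t' := by
          intro t t' htt; cases t <;> cases t' <;> norm_num at htt <;> rfl
        obtain ⟨h0, h1, h2, h3⟩ := h
        have hfst : b.1 = bs.1 := by
          funext k
          have h3k : ∀ i : Fin 3, i = 0 ∨ i = 1 ∨ i = 2 := by decide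
          rcases h3k k with rfl | rfl | rfl
          · exact hbool _ _ h0
          · exact hbool _ _ h1
          · exact hbool _ _ h2
        exact Prod.ext hfst (hbool _ _ h3)
      by_cases c0 : (if b.1 0 then (1 : ℝ) else -1) = (if bs.1 0 then (1 : ℝ) else -1)
      · by_cases c1 : (if b.1 1 then (1 : ℝ) else -1) = (if bs.1 1 then (1 : ℝ) else -1)
        · by_cases c2 : (if b.1 2 then (1 : ℝ) else -1) = (if bs.1 2 then (1 : ℝ) else -1)
          · have c3 : ¬ (if b.2 then (1 : ℝ) else -1) = (if bs.2 then (1 : ℝ) else -1) := fun c3 => hne ⟨c0, c1, c2, c3⟩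
            rw [if_neg c3]; ring
          · rw [if_neg c2]; ring
        · rw [if_neg c1]; ring
      · rw [if_neg c0]; ring
  have hsumsel : ∀ X : (Fin 3 → Bool) × Bool → ℝ, ∑ b, W b Mx * X b = X bs := by
    intro X
    simp only [hWval, ite_mul, one_mul, zero_mul, Finset.sum_ite_eq', Finset.mem_univ, if_true]
  -- the weights are flat at the point
  have hWD : ∀ b (Y : ((Fin (2 * L - 1 + 1) × Edge 3 L) ⊕ Site 3 L) → Matrix (Fin 2) (Fin 2) ℂ), frameD Y (W b) Mx = 0 := by
    intro b Y
    have hD : ∀ (c : ℝ) (k : Fin 3), frameD Y (fun M => (1 + c * linkSign k M) / 2) Mx = 0 := by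
      intro c k
      have e : (fun M : ((Fin (2 * L - 1 + 1) → Edge 3 L → Matrix (Fin 2) (Fin 2) ℂ) × (Site 3 L → Matrix (Fin 2) (Fin 2) ℂ)) => (1 + c * linkSign k M) / 2) =
          fun M => 1 / 2 + (c / 2) * linkSign k M := by funext M; ring
      rw [e, frameD_affine (contDiff_linkSign k), hDsel k Y, mul_zero]
    have hDS : ∀ c : ℝ, frameD Y (fun M => (1 + c * seamSign M) / 2) Mx = 0 := by
      intro c
      have e : (fun M : ((Fin (2 * L - 1 + 1) → Edge 3 L → Matrix (Fin 2) (Fin 2) ℂ) × (Site 3 L → Matrix (Fin 2) (Fin 2) ℂ)) => (1 + c * seamSign M) / 2) =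
          fun M => 1 / 2 + (c / 2) * seamSign M := by funext M; ring
      rw [e, frameD_affine contDiff_seamSign, hDselS Y, mul_zero]
    simp only [hWdef]
    rw [frameD_mul (((hfac _ 0).mul (hfac _ 1)).mul (hfac _ 2)) (hfacS _), frameD_mul ((hfac _ 0).mul (hfac _ 1)) (hfac _ 2),
      frameD_mul (hfac _ 0) (hfac _ 1), hD, hD, hD, hDS]
    ring
  -- the three identities at the point
  have hdrive : ∑ va, (∑ b, W b Mx * Cfam b va Mx) * frameGrad (L := L) fixFrameStd Mx va = ∑ va, Cfam bs va Mx * frameGrad (L := L) fixFrameStd Mx va := by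
    refine Finset.sum_congr rfl fun va _ => ?_
    rw [hsumsel (fun b => Cfam b va Mx)]
  have hdiv : ∑ va, frameD (fixFrameStd va) (fun M => ∑ b, W b M * Cfam b va M) Mx = ∑ va, frameD (fixFrameStd va) (Cfam bs va) Mx := by
    refine Finset.sum_congr rfl fun va _ => ?_
    rw [frameD_finset_sum' Finset.univ (fun b => (hWs b).mul (hCs b va))]
    have e : ∀ b, frameD (fixFrameStd va) (fun M => W b M * Cfam b va M) Mx = W b Mx * frameD (fixFrameStd va) (Cfam b va) Mx := by
      intro b
      rw [frameD_mul (hWs b) (hCs b va), hWD b, mul_zero, add_zero]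
    simp only [e]
    exact hsumsel (fun b => frameD (fixFrameStd va) (Cfam b va) Mx)
  have hmass : ∀ m : ((Fin (2 * L - 1 + 1) → Edge 3 L → Matrix (Fin 2) (Fin 2) ℂ) × (Site 3 L → Matrix (Fin 2) (Fin 2) ℂ)) → ℝ,
      ∑ va, (∑ b, W b Mx * Cfam b va Mx) * frameD (fixFrameStd va) m Mx = ∑ va, Cfam bs va Mx * frameD (fixFrameStd va) m Mx := by
    intro m
    refine Finset.sum_congr rfl fun va _ => ?_
    rw [hsumsel (fun b => Cfam b va Mx)]
  -- the selected chart's package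
  obtain ⟨h2, h3, h4, h5⟩ := hP bs x hk hs (fun k => by rw [hsgn3 k]; exact (hsel k).2) (by rw [hsgn4]; exact hselS.2) hF
  refine ⟨?_, ?_, fun k => ?_, ?_⟩
  · rw [hdrive]; exact h2
  · rw [hdiv]; exact h3
  · rw [hmass]; exact h4 k
  · rw [hmass]; exact h5

/-! ## §3 `PeriodicSoftness` from per-sign central packages -/

/-- ★★★ **`PeriodicSoftness` FROM PER-SIGN CENTRAL PACKAGES.**  If for all large `L` there are `ρ ∈ [(K_C L^{q_C})⁻¹, 1/2]`,
`t_C ≥ (K_C L^{q_C})⁻¹`, `0 ≤ N ≤ K_C L^{q_C}`, `ε_C` with `ε_C·L⁴ ≤ 1/400` and, for each of the 16 sign patterns `b`, SMOOTH coefficient functions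
`C_b` satisfying (P2) `2(1−ε_C)F_fix ≤ Σ C_b·g`, (P3) `Σ ∂C_b ≤ 18L⁴ − 1/2`, (P4) `−N√F_fix ≤ Σ C_b·∂m` (four masses) at the points of the closed
`ρ`-central window carrying the sign pattern `b` (`½ ≤ s(b₁k)·Re su2Quat(w_k)`, `½ ≤ s(b₂)·Re su2Quat(seam root)`), then the deciding crux
`VirialFluxGap.PeriodicSoftness` holds BY NAME (✓`exists_centralField_of_signCharts` + ✓`periodicSoftness_of_centralField`).  CONDITIONAL on the
per-sign packages (w3 lineage: `C_b := centralCoeff L (s∘b₁) (s b₂)`). [cite: Luscher1983, §2] -/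
theorem periodicSoftness_of_signCharts
    (h : ∃ K_C : ℝ, 1 ≤ K_C ∧ ∃ q_C : ℕ, ∃ L₀ : ℕ, ∀ (L : ℕ) [NeZero L], L₀ ≤ L →
      ∃ (ρ t_C N ε_C : ℝ)
        (Cfam : (Fin 3 → Bool) × Bool → FixVar L × Fin 3 →
          ((Fin (2 * L - 1 + 1) → Edge 3 L → Matrix (Fin 2) (Fin 2) ℂ) × (Site 3 L → Matrix (Fin 2) (Fin 2) ℂ)) → ℝ),
        (K_C * (L : ℝ) ^ q_C)⁻¹ ≤ ρ ∧ ρ ≤ 1 / 2 ∧ (K_C * (L : ℝ) ^ q_C)⁻¹ ≤ t_C ∧ 0 ≤ N ∧ N ≤ K_C * (L : ℝ) ^ q_C ∧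
        ε_C * (L : ℝ) ^ 4 ≤ 1 / 400 ∧ (∀ b va, ContDiff ℝ ∞ (Cfam b va)) ∧
        ∀ (b : (Fin 3 → Bool) × Bool) (x : (OffIdx L → SU2) × ((Fin (2 * L - 1) → GaugeConfig 3 L SU2) × (Site 3 L → SU2))),
          (∀ k : Fin 3, 1 - (su2Quat (wrapReps ((Fin.cons (glue x.1) x.2.1 : Fin (2 * L - 1 + 1) → GaugeConfig 3 L SU2) 0) k)).re ^ 2 ≤ ρ ^ 2) →
          1 - (su2Quat (x.2.2 0)).re ^ 2 ≤ ρ ^ 2 →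
          (∀ k : Fin 3, 1 / 2 ≤ (if b.1 k then (1 : ℝ) else -1) *
            (su2Quat (wrapReps ((Fin.cons (glue x.1) x.2.1 : Fin (2 * L - 1 + 1) → GaugeConfig 3 L SU2) 0) k)).re) →
          1 / 2 ≤ (if b.2 then (1 : ℝ) else -1) * (su2Quat (x.2.2 0)).re →
          ringDeficit L (fun _ => false) ((Fin.cons (glue x.1) x.2.1 : Fin (2 * L - 1 + 1) → GaugeConfig 3 L SU2), x.2.2) ≤ t_C →
          2 * (1 - ε_C) * ringDeficit L (fun _ => false) ((Fin.cons (glue x.1) x.2.1 : Fin (2 * L - 1 + 1) → GaugeConfig 3 L SU2), x.2.2) ≤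
              ∑ va, Cfam b va (ringCoord L ((Fin.cons (glue x.1) x.2.1 : Fin (2 * L - 1 + 1) → GaugeConfig 3 L SU2), x.2.2)) *
                frameGrad (L := L) fixFrameStd (ringCoord L ((Fin.cons (glue x.1) x.2.1 : Fin (2 * L - 1 + 1) → GaugeConfig 3 L SU2), x.2.2)) va ∧
            ∑ va, frameD (fixFrameStd va) (Cfam b va) (ringCoord L ((Fin.cons (glue x.1) x.2.1 : Fin (2 * L - 1 + 1) → GaugeConfig 3 L SU2), x.2.2)) ≤
              18 * (L : ℝ) ^ 4 - 1 / 2 ∧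
            (∀ k : Fin 3, -(N * Real.sqrt (ringDeficit L (fun _ => false) ((Fin.cons (glue x.1) x.2.1 : Fin (2 * L - 1 + 1) → GaugeConfig 3 L SU2), x.2.2))) ≤
              ∑ va, Cfam b va (ringCoord L ((Fin.cons (glue x.1) x.2.1 : Fin (2 * L - 1 + 1) → GaugeConfig 3 L SU2), x.2.2)) *
                frameD (fixFrameStd va) (linkMass k) (ringCoord L ((Fin.cons (glue x.1) x.2.1 : Fin (2 * L - 1 + 1) → GaugeConfig 3 L SU2), x.2.2))) ∧
            -(N * Real.sqrt (ringDeficit L (fun _ => false) ((Fin.cons (glue x.1) x.2.1 : Fin (2 * L - 1 + 1) → GaugeConfig 3 L SU2), x.2.2))) ≤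
              ∑ va, Cfam b va (ringCoord L ((Fin.cons (glue x.1) x.2.1 : Fin (2 * L - 1 + 1) → GaugeConfig 3 L SU2), x.2.2)) *
                frameD (fixFrameStd va) seamMass (ringCoord L ((Fin.cons (glue x.1) x.2.1 : Fin (2 * L - 1 + 1) → GaugeConfig 3 L SU2), x.2.2))) :
    Summit.QuantumFields.YangMills.Theses.VirialFluxGap.PeriodicSoftness := by
  obtain ⟨K_C, hK_C, q_C, L₀, hpack⟩ := h
  refine periodicSoftness_of_centralField ⟨K_C, hK_C, q_C, L₀, fun L _ hL => ?_⟩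
  obtain ⟨ρ, t_C, N, ε_C, Cfam, hρlo, hρhi, htC, hN0, hN, hεC, hCs, hP⟩ := hpack L hL
  have hρ0 : 0 < ρ := by
    have hKC0 : 0 < K_C := by linarith
    have : (0 : ℝ) < (K_C * (L : ℝ) ^ q_C)⁻¹ := by
      have hL0 : (0 : ℝ) < L := by exact_mod_cast NeZero.pos L
      positivity
    linarith
  have hρ2 : ρ ^ 2 ≤ 3 / 4 := by nlinarith only [hρ0, hρhi]
  obtain ⟨C, hC, hCP⟩ := exists_centralField_of_signCharts (L := L) hρ2 Cfam hCs hP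
  exact ⟨ρ, t_C, N, ε_C, C, hρlo, hρhi, htC, hN0, hN, hεC, hC, hCP⟩

end Summit.QuantumFields.YangMills.Theorems.VirialFluxGap.FrameHessian

end
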